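import Summits.BirchSwinnertonDyer.BirchSwinnertonDyer.Theorems.MordellShaFreeCutThreeAdicBDPExistsValue
import Summits.BirchSwinnertonDyer.BirchSwinnertonDyer.Theorems.MordellShaFreeCutResidualCensusPTFree

set_option linter.dupNamespace false
set_option autoImplicit false

/-! # Route `MordellShaFreeCut` (rung S2b) — the RESIDUAL side of the BDP road in the folded currency
(LB-exist∧bdp)∃ `ThreeAdicBDPElementExistsWithValue`: the corank-currency plumbing re-proved, crux A
`RankPosOfThreeSelmerCorankOne` ⟸ (res) at `3`, and the whole route (the leaf) in that currency

Cell `bsd-cn100`, prover seat `bsd-cn100-s2b-c3` (g7); sibling of `MordellShaFreeCutThreeAdicBDPExistsValue.lean`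
(400-line rule). Supports, does not close, stmt-BirchSwinnertonDyer-19160; serves the registered BDP line
`heegner-field-bdp-triple` v6bp on stmt-BirchSwinnertonDyer-19159 (residual crux A). Ports of p440480
(`MordellShaFreeCutBDPTripleCensus`) and p457636 (`MordellShaFreeCutResidualCensusPTFree`) with the pair
(LB-exist) ∧ (LB-bdp, ∀-frame) replaced by the single weaker ∃∧ statement «ONE frame WITH its value at 𝟙»:

* `heegnerPoint_not_isOfFinAddOrder_of_corankLinkA_of_bdpExistsValue` — Link A in CORANK form +
  (LB-exist∧bdp)∃ + (LB-wan) ⟹ every Heegner point at a corank-one datum is non-torsion (no Kato, no rank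
  input; p440480's proof with one `obtain` instead of two);
* `rankPos_minimal_of_corankLinkA_of_bdpExistsValue` — globally minimal `j = 0` case of crux A;
* `cruxA_of_res_of_bdpExistsValue` — crux A ⟸ (res) at `3` + (LB-exist∧bdp)∃ + (LB-wan) + five refereed
  facts (Link A in corank form being the PT-free `threeAdicControlOfCorankOne_of_locNonDegeneracy`);
* `leaf_of_res_of_bdpExistsValue` — THE ROUTE'S KERNEL CENSUS in the folded currency: the leaf
  `rankOne_threeConverse_mordellCurve` ⟸ {(res), (LB-exist∧bdp)∃, (LB-wan)} + six refereed facts.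

HONEST FRAMING: CONDITIONAL reductions only; nothing here proves crux A, crux B, the leaf, Sylvester's
conjecture or any case of BSD. (res) at `3` is the hypothesis `hres` spelled exactly as the registered
`stub_threeLocNonDegeneracy`. PARTITION: none — RANK axis.

[cite: Skinner2020, Thm. B and §2.2–2.3 (shape of (res))] [cite: CastellaGrossiLeeSkinner2022, §5.2 (proof of Thm. 5.2.1), Thm. 5.1.3]
[cite: Castella2018, proof of Thm. 2.3 with Thm. 3.4 (shape)] [cite: GrossZagier1986, Thm. I.6.3 with V.§2] -/

noncomputable section

open scoped Classical

namespace Summit.BirchSwinnertonDyer.BirchSwinnertonDyer.Theorems.MordellShaFreeCutThreeAdicBDPExistsValueResidual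

open PowerSeries WeierstrassCurve NumberField IsDedekindDomain Field Literature.NumberTheory.EllipticCurves
  Literature.NumberTheory.EllipticCurves.ModularForms Literature.NumberTheory.QuadraticFields
  Literature.NumberTheory.EllipticCurves.Castella2018
open Literature.NumberTheory.GaloisRepresentations Literature.NumberTheory.GaloisCohomology
open Summit.BirchSwinnertonDyer.BirchSwinnertonDyer.Theses.MordellShaFreeCut
open Summit.BirchSwinnertonDyer.BirchSwinnertonDyer.Theorems.MordellShaFreeCutThreeAdicLinksCorank
  (ThreeAdicControlOfCorankOne)
open Summit.BirchSwinnertonDyer.BirchSwinnertonDyer.Theorems.MordellShaFreeCutThreeAdicBDPTriple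
  (ThreeAdicWanDivisibility)
open Summit.BirchSwinnertonDyer.BirchSwinnertonDyer.Theorems.MordellShaFreeCutThreeAdicBDPExistsValue
  (ThreeAdicBDPElementExistsWithValue cruxB_of_bdpExistsValue)
open Summit.BirchSwinnertonDyer.BirchSwinnertonDyer.Theorems.MordellShaFreeCutResidualCensusPTFree
  (threeAdicControlOfCorankOne_of_locNonDegeneracy)

/-! ## 1. Corank-currency plumbing from (LB-exist∧bdp)∃ + (LB-wan) -/

/-- **Corank-currency plumbing from the folded statement** (port of p440480's
`heegnerPoint_not_isOfFinAddOrder_of_corankLinkA_of_bdpTriple`, no Kato, no rank hypothesis): Link A in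
corank form (`hAc`) + (LB-exist∧bdp)∃ + (LB-wan) force every Heegner point at a corank-one datum to be
non-torsion (`𝓛(𝟙) ∣`-bookkeeping by b2b's `X11b.Halves.two_mul_sub_one_le_valuation` with `a = 0`).
CONDITIONAL; credits nothing. [cite: CastellaGrossiLeeSkinner2022, §5.2 (proof of Thm. 5.2.1)]
[cite: Castella2018, proof of Thm. 2.3 with Thm. 3.4 (shape)] [cite: SilvermanAEC2009, IV.6.4 and VII.2.2] -/
theorem heegnerPoint_not_isOfFinAddOrder_of_corankLinkA_of_bdpExistsValue
    (hAc : ThreeAdicControlOfCorankOne) (hEV : ThreeAdicBDPElementExistsWithValue)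
    (hWan : ThreeAdicWanDivisibility) :
    ∀ (W : WeierstrassCurve ℚ) [W.IsElliptic] [W.IsGloballyMinimal], W.j = 0 →
      ∀ (K : Type) [Field K] [NumberField K] (N : ℕ) [NeZero N], W.conductorNorm ℤ = N →
        IsImaginaryQuadratic K → SatisfiesHeegnerHypothesis N K → SatisfiesHeegnerHypothesis 3 K →
          (W.baseChange K).selmerCorank 3 = 1 →
            ∀ (P : (W.baseChange K).toAffine.Point), IsHeegnerPoint N W K P → ¬ IsOfFinAddOrder P := by
  intro W _ _ hj K _ _ N _ hN hK hHN hH3 hcK P hP hPtor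
  haveI : Fact (Nat.Prime 3) := ⟨Nat.prime_three⟩
  have hsplit : ((Ideal.span {(3 : ℤ)}).primesOver (𝓞 K)).ncard = 2 :=
    hH3 3 Nat.prime_three (dvd_refl 3)
  -- (1) the anticyclotomic datum, THE embedding at a degree-one `v ∣ 3`, the partner `v̄`
  obtain ⟨κ, γ, v, hκ, hγ, hv3, he, hf⟩ :=
    Summit.BirchSwinnertonDyer.Rank1Residual.X11b.exists_anticyclotomic_generator_degreeOnePrime 3 K hK hH3
  haveI : Fact (κ.IsTopGenerator γ) := ⟨hγ⟩
  set ι : K →+* ℚ_[3] := Summit.BirchSwinnertonDyer.Rank1Residual.X11b.embAt K 3 v hv3 he hf with hιdef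
  have hv : ∀ x : 𝓞 K, x ∈ v.asIdeal ↔ ‖ι (x : K)‖ < 1 :=
    Summit.BirchSwinnertonDyer.Rank1Residual.X11b.mem_asIdeal_iff_norm_embAt_lt_one v hv3 he hf
  obtain ⟨vbar, hvbar, hne⟩ :=
    Summit.BirchSwinnertonDyer.Rank1Residual.X11b.exists_other_prime hH3 v hv3
  -- (2) Link A (corank form): a generator `F` of `char_Λ 𝔛` with `F(0) ≠ 0`
  obtain ⟨m, hm⟩ := hAc W hj K N hN hK hHN hH3 ι v vbar hv hvbar hne κ hκ γ hcK
  obtain ⟨-, F, hF, hF0, -⟩ := hm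
  have hFmem : F ∈ AcSelmer.XAc.charIdeal (W.baseChange K) 3 κ vbar ∅ γ := by
    rw [hF]; exact Ideal.mem_span_singleton_self F
  -- (3) the Heegner point data; its Galois conjugate readable at an infinite place
  obtain ⟨Dt, H, ιK, hPK⟩ := hP
  obtain ⟨w₀⟩ := (inferInstance : Nonempty (InfinitePlace K))
  haveI : IsGalois ℚ K := by
    haveI : Algebra.IsQuadraticExtension ℚ K := ⟨hK.1⟩
    infer_instance
  obtain ⟨σ, hσ⟩ := NumberField.ComplexEmbedding.exists_comp_symm_eq_of_comp_eq (k := ℚ)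
    w₀.embedding ιK (by ext x; simp)
  set τ : K →+* K := ((σ.symm : K ≃ₐ[ℚ] K) : K →+* K) with hτdef
  set P' := WeierstrassCurve.Affine.Point.map τ.toRatAlgHom P with hP'def
  have hP' : WeierstrassCurve.Affine.Point.map w₀.embedding.toRatAlgHom P' =
      heegnerPointComplex Dt H := by
    rw [hP'def, WeierstrassCurve.Affine.Point.map_map]
    have hcomp : w₀.embedding.toRatAlgHom.comp τ.toRatAlgHom = ιK.toRatAlgHom := by
      apply AlgHom.ext
      intro x
      have := RingHom.congr_fun hσ x
      simpa [hτdef] using this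
    rw [hcomp]
    exact hPK
  have hP'tor : IsOfFinAddOrder P' := by
    rw [hP'def]; exact AddMonoidHom.isOfFinAddOrder _ hPtor
  -- (4) (LB-exist∧bdp)∃ at the conjugate reading `P'`: ONE frame WITH its value at `𝟙`
  obtain ⟨ι', hι', ΩK, Ωp, L, hΩK, hBDP, u, hu⟩ :=
    hEV W hj K N Dt H w₀ ι v κ γ P' hN hK hHN hsplit hv3 hκ hP' hv
  -- (5) (LB-wan) along `toUnr : ℤ₃ → R₀`
  obtain ⟨k, hk⟩ := hWan W hj ι' K N Dt v vbar κ γ hN hK hHN hsplit hι' hvbar hne hκ ΩK Ωp L hΩK hBDP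
    (Summit.BirchSwinnertonDyer.Rank1Residual.X11b.Halves.toUnr 3)
    (Summit.BirchSwinnertonDyer.Rank1Residual.X11b.Halves.coe_toUnr 3)
  set F' : IwasawaAlgebra 3 := C ((3 : ℤ_[3]) ^ k) * F with hF'def
  have hF'0 : constantCoeff F' ≠ 0 := by
    rw [hF'def, map_mul, PowerSeries.constantCoeff_C]
    exact mul_ne_zero (pow_ne_zero _ (by norm_num)) hF0
  have hfL : PowerSeries.map (Summit.BirchSwinnertonDyer.Rank1Residual.X11b.Halves.toUnr 3) F' ∈
      Ideal.span {L} := by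
    have hmap : PowerSeries.map (Summit.BirchSwinnertonDyer.Rank1Residual.X11b.Halves.toUnr 3) F' =
        C ((3 : unrIntegers 3) ^ k) *
          PowerSeries.map (Summit.BirchSwinnertonDyer.Rank1Residual.X11b.Halves.toUnr 3) F := by
      rw [hF'def, map_mul, PowerSeries.map_C, map_pow, map_ofNat]
    rw [hmap]
    exact hk F hFmem
  -- (6) the value at `𝟙` in the shape of the halves algebra
  set x : ℚ_[3] := (Dt.c : ℚ_[3])⁻¹ *
      (1 - (W.LFunction 3 : ℚ_[3]) * (3 : ℚ_[3])⁻¹ + (if (3 : ℕ) ∣ N then 0 else (3 : ℚ_[3])⁻¹)) *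
      padicLogOmega W 3 ι P' with hxdef
  have hshape : ((Dt.c : ℚ_[3])⁻¹) ^ 2 *
      (1 - (W.LFunction 3 : ℚ_[3]) * (3 : ℚ_[3])⁻¹ + (if (3 : ℕ) ∣ N then 0 else (3 : ℚ_[3])⁻¹)) ^ 2 *
      (padicLogOmega W 3 ι P') ^ 2 =
      (((1 : ℚ_[3]) - ((0 : ℤ) : ℚ_[3]) * ((3 : ℕ) : ℚ_[3])⁻¹) * x) ^ 2 := by
    rw [hxdef]; push_cast; ring
  rw [hshape, map_pow] at hu
  -- (7) the algebra of halves: `x ≠ 0`, hence `log_ω P' ≠ 0`; a torsion point has zero logarithm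
  obtain ⟨hx0, -⟩ :=
    Summit.BirchSwinnertonDyer.Rank1Residual.X11b.Halves.two_mul_sub_one_le_valuation 3 hF'0 hfL u 0 hu
  apply hx0
  rw [hxdef]
  unfold padicLogOmega
  rw [AcPConverseLinks.padicLogPoint_formalIndex_smul_eq_zero_of_isOfFinAddOrder W 3 ι hP'tor, zero_div,
    mul_zero]

/-! ## 2. Crux A from (res), and the whole route, in the folded currency -/

/-- **Globally minimal `j = 0` case of crux A from Link A in corank form, (LB-exist∧bdp)∃ and (LB-wan)**
(port of `rankPos_minimal_of_corankLinkA_of_bdpTriple`, p440480): descend to the Heegner field `K`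
(`exists_heegnerField_descent_of_selmerCorank_eq_one`), take a Heegner point, apply the corank-currency
plumbing, Mordell–Weil. CONDITIONAL; credits nothing. [cite: CastellaGrossiLeeSkinner2022, §5.2 (proof of Thm. 5.2.1)] -/
theorem rankPos_minimal_of_corankLinkA_of_bdpExistsValue
    (hpar : ∀ (W : WeierstrassCurve ℚ) [W.IsElliptic] (p : ℕ) [Fact p.Prime], p_parity W p)
    (hmod : ModularForms.exists_isNewformOf) (hHL : HoffsteinLuo1997_exists_twist_L_one_ne_zero)
    (hKato : ∀ (W : WeierstrassCurve ℚ) [W.IsElliptic] (p : ℕ) [Fact p.Prime],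
      kato_finite_of_L_one_ne_zero W p)
    (hHP : ∀ (W : WeierstrassCurve ℚ) (K : Type) [Field K] [NumberField K],
      exists_isHeegnerPoint W K)
    (hAc : ThreeAdicControlOfCorankOne) (hEV : ThreeAdicBDPElementExistsWithValue)
    (hWan : ThreeAdicWanDivisibility) :
    ∀ (W : WeierstrassCurve ℚ) [W.IsElliptic] [W.IsGloballyMinimal], W.j = 0 →
      W.selmerCorank 3 = 1 → 1 ≤ W.mordellWeilRank := by
  intro W _ _ hj hc
  haveI : Fact (Nat.Prime 3) := ⟨Nat.prime_three⟩
  haveI : NeZero (W.conductorNorm ℤ) := ⟨(W.conductorNorm_pos_holds).ne'⟩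
  obtain ⟨K, _, _, hK, -, hHN, hH3, -, -, hcK, hrk, -⟩ :=
    exists_heegnerField_descent_of_selmerCorank_eq_one hpar hmod hHL hKato W 3 hc 0
  obtain ⟨P, hP⟩ := hHP W K hK hHN
  have hPnt : ¬ IsOfFinAddOrder P :=
    heegnerPoint_not_isOfFinAddOrder_of_corankLinkA_of_bdpExistsValue hAc hEV hWan W hj K
      (W.conductorNorm ℤ) rfl hK hHN hH3 hcK P hP
  have hrkK : 1 ≤ (W.baseChange K).mordellWeilRank :=
    one_le_mordellWeilRank_of_not_isOfFinAddOrder _ (W.baseChange K).module_finite_point_holds hPnt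
  rwa [hrk] at hrkK

/-- **Crux A `RankPosOfThreeSelmerCorankOne` ⟸ (res) at `3` + (LB-exist∧bdp)∃ + (LB-wan) + five refereed facts**
(`3`-parity, modularity, Hoffstein–Luo, Kato, existence of Heegner points): Link A in corank form is the
PT-free `MordellShaFreeCutResidualCensusPTFree.threeAdicControlOfCorankOne_of_locNonDegeneracy hres`
(p457636), then `rankPos_minimal_of_corankLinkA_of_bdpExistsValue` and the minimal-model reduction
(globally minimal model `C • E_D`, `j = 0`, Selmer corank and rank invariant under the change of
variables). (res) is spelled exactly as the registered `stub_threeLocNonDegeneracy`. CONDITIONAL; credits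
nothing. [cite: SilvermanAEC2009, III.3.1(b) and VIII.8] [cite: Skinner2020, Thm. B and §2.2–2.3 (shape of (res))] -/
theorem cruxA_of_res_of_bdpExistsValue
    (hpar : ∀ (W : WeierstrassCurve ℚ) [W.IsElliptic] (p : ℕ) [Fact p.Prime], p_parity W p)
    (hmod : ModularForms.exists_isNewformOf) (hHL : HoffsteinLuo1997_exists_twist_L_one_ne_zero)
    (hKato : ∀ (W : WeierstrassCurve ℚ) [W.IsElliptic] (p : ℕ) [Fact p.Prime],
      kato_finite_of_L_one_ne_zero W p)
    (hHP : ∀ (W : WeierstrassCurve ℚ) (K : Type) [Field K] [NumberField K],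
      exists_isHeegnerPoint W K)
    (hres : ∀ (W : WeierstrassCurve ℚ) [W.IsElliptic] [W.IsGloballyMinimal], W.j = 0 →
      ∀ (K : Type) [Field K] [NumberField K],
      IsImaginaryQuadratic K → SatisfiesHeegnerHypothesis 3 K →
        (W.baseChange K).selmerCorank 3 = 1 →
      ∀ (w : HeightOneSpectrum (𝓞 K)), ((3 : ℕ) : 𝓞 K) ∈ w.asIdeal →
        Finite ↥((W.baseChange K).selmerGroupPInfty 3 ⊓
          selmerLocalKerPrimaryTorsion (W.baseChange K) (w.adicCompletion K) 3))
    (hEV : ThreeAdicBDPElementExistsWithValue) (hWan : ThreeAdicWanDivisibility) :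
    RankPosOfThreeSelmerCorankOne := by
  intro D hD hc
  haveI := isElliptic_mordellCurve hD
  haveI : Fact (Nat.Prime 3) := ⟨Nat.prime_three⟩
  obtain ⟨C, hmin⟩ := hasGlobalMinimalModel_rat_holds (mordellCurve D)
  haveI : (C • mordellCurve D).IsGloballyMinimal := hmin
  have hj : (C • mordellCurve D).j = 0 := by
    rw [variableChange_j]; exact (mordellCurve D).j_eq_zero (mordellCurve_c₄ _)
  have hc' : (C • mordellCurve D).selmerCorank 3 = 1 := by
    rw [← selmerCorank_eq_of_variableChange 3 (rfl : C • mordellCurve D = C • mordellCurve D)]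
    exact hc
  have h1 := rankPos_minimal_of_corankLinkA_of_bdpExistsValue hpar hmod hHL hKato hHP
    (threeAdicControlOfCorankOne_of_locNonDegeneracy hres) hEV hWan (C • mordellCurve D) hj hc'
  rwa [mordellWeilRank_variableChange_holds] at h1

/-- **THE ROUTE'S KERNEL CENSUS in the folded currency: the rung-S2b leaf `rankOne_threeConverse_mordellCurve`
⟸ {(res) at `3`, (LB-exist∧bdp)∃, (LB-wan)} + six refereed facts** (`3`-parity, modularity, Hoffstein–Luo,
Kato, Gross 1984, Gross–Zagier + Kolyvagin) — the route's Assembly (`MordellShaFreeCutAssembly.assembly_holds`)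
of `cruxA_of_res_of_bdpExistsValue` and `cruxB_of_bdpExistsValue`; no textbook hypothesis (Poitou–Tate at the
imaginary quadratic fields is a tree theorem). Research content of the route on the BDP road = ONE
Selmer-only statement + ONE construction-with-value + ONE main-conjecture divisibility, all at the additive
prime `3`. CONDITIONAL; neither BSD nor Sylvester's conjecture is touched.
[cite: GrossZagier1986, Thm. I.6.3 with V.§2] [cite: CastellaGrossiLeeSkinner2022, §5.2 (proof of Thm. 5.2.1)] -/
theorem leaf_of_res_of_bdpExistsValue
    (hpar : ∀ (W : WeierstrassCurve ℚ) [W.IsElliptic] (p : ℕ) [Fact p.Prime], p_parity W p)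
    (hmod : ModularForms.exists_isNewformOf) (hHL : HoffsteinLuo1997_exists_twist_L_one_ne_zero)
    (hKato : ∀ (W : WeierstrassCurve ℚ) [W.IsElliptic] (p : ℕ) [Fact p.Prime],
      kato_finite_of_L_one_ne_zero W p)
    (hHP : ∀ (W : WeierstrassCurve ℚ) (K : Type) [Field K] [NumberField K],
      exists_isHeegnerPoint W K)
    (hGZ : ∀ (W : WeierstrassCurve ℚ) (N : ℕ) [NeZero N] (K : Type) [Field K] [NumberField K],
      analyticRankEK_eq_one_iff_heegner_nonTorsion W N K)
    (hres : ∀ (W : WeierstrassCurve ℚ) [W.IsElliptic] [W.IsGloballyMinimal], W.j = 0 →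
      ∀ (K : Type) [Field K] [NumberField K],
      IsImaginaryQuadratic K → SatisfiesHeegnerHypothesis 3 K →
        (W.baseChange K).selmerCorank 3 = 1 →
      ∀ (w : HeightOneSpectrum (𝓞 K)), ((3 : ℕ) : 𝓞 K) ∈ w.asIdeal →
        Finite ↥((W.baseChange K).selmerGroupPInfty 3 ⊓
          selmerLocalKerPrimaryTorsion (W.baseChange K) (w.adicCompletion K) 3))
    (hEV : ThreeAdicBDPElementExistsWithValue) (hWan : ThreeAdicWanDivisibility) :
    rankOne_threeConverse_mordellCurve :=
  MordellShaFreeCutAssembly.assembly_holds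
    (cruxA_of_res_of_bdpExistsValue hpar hmod hHL hKato hHP hres hEV hWan)
    (cruxB_of_bdpExistsValue hpar hmod hHL hKato hHP hGZ hEV hWan)

end Summit.BirchSwinnertonDyer.BirchSwinnertonDyer.Theorems.MordellShaFreeCutThreeAdicBDPExistsValueResidual

end
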